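import Mathlib
import Summits.CriticalPhenomena.CardyFormulaZ2.Theorems.CardyMagicRigidityNestingRigidityTreeRigidityTameAssemblyRigid
import Summits.CriticalPhenomena.CardyFormulaZ2.Theorems.CardyMagicRigidityNestingRigidityTreeRigidityTameAssemblyCoupling
import HarnessLib

/-!
# Stub `treeRigidityTame_of_tameRigidity`, ROUTING-BLIND core: equal typed cylinder laws ⇒ a coupling with
# equal typed counts and interior-and-type-preserving bijections of the loops

Crux `Summit.CriticalPhenomena.CardyFormulaZ2.Theses.CardyMagicRigidity.NestingRigidity`
(stmt-CriticalPhenomena-4835), line `positive-cone-weight-doubling`, registered helper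
`treeRigidityTame_of_tameRigidity` (vocabulary of `Theorems/CardyMagicRigidityPositiveConeJointDefs.lean`,
p130599).  The lead reports (2026-08-16) that the TAME RIGIDITY hypothesis of that helper is refuted by a
"two-mouth lake" (two Eulerian traversals of a circle with two inner touching circles: same winding function,
positive `udist`), so every step of the assembly that does not use rigidity is landed here on its own, with
conclusions that a repaired route can consume whatever the eventual support class:

* §1 `typedCounts_one_disc_of_typedCounts_eq`, `typedCounts_two_disc_of_typedCounts_eq` — equal typed
  two-disc pattern counts at positive rational data give the per-type one-disc and two-disc surround counts
  at ALL windows (padding by an inert far disc, `patternCount_pad_eq`; rational windows suffice,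
  `patternCount_eq_of_forall_rat`; both p131405); `exists_typed_interiorEquiv_of_typedCounts_eq`
  (registered anchor, CONFIGURATION LEVEL) — for two `Regular` configurations this forces, type by type,
  a bijection of the loops preserving the winding interiors (`exists_interiorEquiv_of_counts_eq`, p118827,
  on the single-type parts, `regular_typeRestrict` / `loops_typeRestrict`, p130005): the TYPED INTERIOR
  MULTISETS agree.  No rigidity, no tameness.
* §2 `exists_coupling_typedCounts_eq_of_typedCylinders_eq` (registered anchor, LAW LEVEL) — two
  presentations on `([0,1], Leb)` with measurable typed counts and equal JOINT typed cylinder probabilities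
  at positive rational data admit a coupling of `(Leb, Leb)` under which ALL typed two-disc pattern counts
  at positive rational radii and rational windows agree almost surely (π-system uniqueness
  `measure_pi_ext_of_cylinders` + coupling along equal laws `exists_coupling_volume_eq_of_map_eq`,
  p131672 / p129918).  No regularity needed.
* §3 `exists_coupling_typed_interiorEquiv_of_typedCylinders_eq` (registered anchor, LAW LEVEL) — if
  moreover both presentations are a.e. `Regular`, the coupling carries, almost surely, interior-and-type-
  preserving bijections between the loops of `X s` and of `X' s'` (§1 pathwise).

What turns §3 into `d_CN((Leb, X), (Leb, X')) = 0` is exactly a rigidity statement "equal winding interior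
(and type) ⇒ `udist = 0`" on the support of the limits — the step now known to need a class finer than
`Tame` (`…TameAssemblyRigid`, `…TameAssemblyCoupling` give it for any winding-injective reversal-closed
single-signed class, via `udist_eq_zero_of_windInjective`).
-/

noncomputable section

open MeasureTheory Set Filter Metric
open scoped Real Topology BigOperators ENNReal

namespace Summit.CriticalPhenomena.CardyFormulaZ2.Cruxes.NestingRigidity.PositiveConeWeightDoubling

open Literature.Probability.RandomPlanarGeometry Literature.Probability.Percolation
  Literature.Probability.LatticeModels
open Summit.CriticalPhenomena.CardyFormulaZ2.Theses.CardyMagicRigidity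
open Summit.CriticalPhenomena.CardyFormulaZ2.Cruxes.NestingRigidity.RingCloudTomography

/-! ## §1 Configuration level: typed interior multisets from typed counts at rational data -/

/-- Componentwise cast of a `2`-vector of rational centres. -/
private theorem ratVec2c (q q' : ℚ × ℚ) :
    (fun j ↦ (⟨((![q, q'] j).1 : ℝ), ((![q, q'] j).2 : ℝ)⟩ : ℂ)) = ![(⟨q.1, q.2⟩ : ℂ), ⟨q'.1, q'.2⟩] := by
  funext j
  fin_cases j <;> rfl

/-- Componentwise cast of a `2`-vector of rational radii. -/
private theorem ratVec2r (s s' : ℚ) : (fun j ↦ ((![s, s'] j : ℚ) : ℝ)) = ![(s : ℝ), s'] := by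
  funext j
  fin_cases j <;> rfl

/-- **Per-type one-disc surround counts at all windows** from equal typed two-disc pattern counts at
positive rational data (pad with the inert far disc `B̄((R' + 2, 0), 1)` at rational windows `R'`, then
pass to all windows by local finiteness). -/
theorem typedCounts_one_disc_of_typedCounts_eq {c c' : LoopConfig ℂ} (hc : Regular c) (hc' : Regular c')
    (h : ∀ (i : Fin 2) (x : Fin 2 → ℚ × ℚ) (r : Fin 2 → ℚ) (R : ℚ) (S : Finset (Fin 2)),
      (∀ j, 0 < r j) → S.Nonempty →
      typedPatternCount c i (fun j ↦ (⟨(x j).1, (x j).2⟩ : ℂ)) (fun j ↦ (r j : ℝ)) R S =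
        typedPatternCount c' i (fun j ↦ (⟨(x j).1, (x j).2⟩ : ℂ)) (fun j ↦ (r j : ℝ)) R S)
    (i : Fin 2) (R : ℝ) (q : ℚ × ℚ) (s : ℚ) (hs : 0 < s) :
    patternCount (⟨fun j ↦ if j = i then c.F i else ∅⟩ : LoopConfig ℂ) ![(⟨q.1, q.2⟩ : ℂ)] ![(s : ℝ)] R
        Finset.univ =
      patternCount (⟨fun j ↦ if j = i then c'.F i else ∅⟩ : LoopConfig ℂ) ![(⟨q.1, q.2⟩ : ℂ)] ![(s : ℝ)] R
        Finset.univ := by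
  refine patternCount_eq_of_forall_rat (regular_typeRestrict hc i).locallyFinite
    (regular_typeRestrict hc' i).locallyFinite _ _ Finset.univ (i := 0) (Finset.mem_univ _)
    (by simpa using hs) (fun R' ↦ ?_) R
  have hfar := disjoint_closedBall_far_ball (R' : ℝ)
  rw [← patternCount_pad_eq _ _ (⟨(R' : ℝ) + 2, 0⟩ : ℂ) _ 1 _ hfar,
    ← patternCount_pad_eq _ _ (⟨(R' : ℝ) + 2, 0⟩ : ℂ) _ 1 _ hfar]
  have key := h i ![q, (R' + 2, 0)] ![s, 1] R' {0}
    (fun j ↦ by fin_cases j <;> simp [hs]) ⟨0, Finset.mem_singleton_self 0⟩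
  rw [typedPatternCount, typedPatternCount, ratVec2c, ratVec2r] at key
  simpa only [Rat.cast_add, Rat.cast_ofNat, Rat.cast_one, Rat.cast_zero] using key

/-- **Per-type two-disc surround counts at all windows** from equal typed two-disc pattern counts at
positive rational data. -/
theorem typedCounts_two_disc_of_typedCounts_eq {c c' : LoopConfig ℂ} (hc : Regular c) (hc' : Regular c')
    (h : ∀ (i : Fin 2) (x : Fin 2 → ℚ × ℚ) (r : Fin 2 → ℚ) (R : ℚ) (S : Finset (Fin 2)),
      (∀ j, 0 < r j) → S.Nonempty →
      typedPatternCount c i (fun j ↦ (⟨(x j).1, (x j).2⟩ : ℂ)) (fun j ↦ (r j : ℝ)) R S =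
        typedPatternCount c' i (fun j ↦ (⟨(x j).1, (x j).2⟩ : ℂ)) (fun j ↦ (r j : ℝ)) R S)
    (i : Fin 2) (R : ℝ) (q q' : ℚ × ℚ) (s s' : ℚ) (hs : 0 < s) (hs' : 0 < s') :
    patternCount (⟨fun j ↦ if j = i then c.F i else ∅⟩ : LoopConfig ℂ) ![(⟨q.1, q.2⟩ : ℂ), ⟨q'.1, q'.2⟩]
        ![(s : ℝ), s'] R Finset.univ =
      patternCount (⟨fun j ↦ if j = i then c'.F i else ∅⟩ : LoopConfig ℂ)
        ![(⟨q.1, q.2⟩ : ℂ), ⟨q'.1, q'.2⟩] ![(s : ℝ), s'] R Finset.univ := by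
  refine patternCount_eq_of_forall_rat (regular_typeRestrict hc i).locallyFinite
    (regular_typeRestrict hc' i).locallyFinite _ _ Finset.univ (i := 0) (Finset.mem_univ _)
    (by simpa using hs) (fun R' ↦ ?_) R
  have key := h i ![q, q'] ![s, s'] R' Finset.univ
    (fun j ↦ by fin_cases j <;> simp [hs, hs']) Finset.univ_nonempty
  rw [typedPatternCount, typedPatternCount, ratVec2c, ratVec2r] at key
  exact key

/-- **Equal typed counts at rational data force equal TYPED INTERIOR MULTISETS (configuration level,
routing-blind; registered anchor).**  Two `Regular` configurations whose typed two-disc pattern counts agree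
at every positive rational datum (rational centres, positive rational radii, rational window, every
non-empty pattern, both types) have, for each type `i`, their type-`i` loops in a bijection preserving the
winding interiors `{W ≠ 0}`.  No rigidity or tameness is used: this is `exists_interiorEquiv_of_counts_eq`
(p118827) on the single-type parts. -/
theorem exists_typed_interiorEquiv_of_typedCounts_eq : ∀ {c c' : LoopConfig ℂ}, Regular c → Regular c' →
    (∀ (i : Fin 2) (x : Fin 2 → ℚ × ℚ) (r : Fin 2 → ℚ) (R : ℚ) (S : Finset (Fin 2)),
      (∀ j, 0 < r j) → S.Nonempty →
      typedPatternCount c i (fun j ↦ (⟨(x j).1, (x j).2⟩ : ℂ)) (fun j ↦ (r j : ℝ)) R S =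
        typedPatternCount c' i (fun j ↦ (⟨(x j).1, (x j).2⟩ : ℂ)) (fun j ↦ (r j : ℝ)) R S) →
    ∀ i : Fin 2, ∃ e : c.F i ≃ c'.F i, ∀ u : c.F i,
      {w | (e u : UnbasedLoop ℂ).wind w ≠ 0} = {w | (u : UnbasedLoop ℂ).wind w ≠ 0} := by
  intro c c' hc hc' h i
  obtain ⟨e, he⟩ := exists_interiorEquiv_of_counts_eq (regular_typeRestrict hc i)
    (regular_typeRestrict hc' i) (typedCounts_one_disc_of_typedCounts_eq hc hc' h i)
    (fun R q q' s s' hs hs' _ ↦ typedCounts_two_disc_of_typedCounts_eq hc hc' h i R q q' s s' hs hs')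
  have hl : (⟨fun j ↦ if j = i then c.F i else ∅⟩ : LoopConfig ℂ).loops = c.F i := loops_typeRestrict c i
  have hl' : (⟨fun j ↦ if j = i then c'.F i else ∅⟩ : LoopConfig ℂ).loops = c'.F i :=
    loops_typeRestrict c' i
  refine ⟨(Equiv.setCongr hl.symm).trans (e.trans (Equiv.setCongr hl')), fun u ↦ ?_⟩
  simp only [Equiv.trans_apply, Equiv.setCongr_apply]
  exact he ⟨u, hl.symm ▸ u.2⟩

/-! ## §2 Law level: a coupling with a.s. equal typed counts, from equal joint typed cylinder laws -/

/-- **Equal joint typed cylinder probabilities give a coupling with a.s. equal typed counts (law level,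
routing-blind; registered anchor).**  Let `X, X'` be presentations on `([0,1], Leb)` with measurable typed
pattern counts, and suppose that for every finite family of positive rational two-disc data and every
table of values the JOINT cylinder probabilities of the typed pattern counts of `X` and `X'` agree.  Then
there is a coupling `P` of `(Leb, Leb)` such that, for `P`-a.e. `(s, s')`, ALL typed two-disc pattern
counts of `X s` and `X' s'` at positive rational radii and rational windows agree.  Proof: the countable
statistic of all these counts (value `0` at the empty pattern) has the same LAW under both presentations
(`measure_pi_ext_of_cylinders`: its tuple point cylinders are the joint cylinder events, or empty), so the
two copies of `[0,1]` can be coupled along it (`exists_coupling_volume_eq_of_map_eq`, p129918). -/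
theorem exists_coupling_typedCounts_eq_of_typedCylinders_eq : ∀ (X X' : unitInterval → LoopConfig ℂ),
    (∀ (i : Fin 2) (n : ℕ) (x : Fin n → ℂ) (r : Fin n → ℝ) (R : ℝ) (S : Finset (Fin n)),
      Measurable (fun s ↦ typedPatternCount (X s) i x r R S) ∧
      Measurable (fun s ↦ typedPatternCount (X' s) i x r R S)) →
    (∀ (J : ℕ) (x : Fin J → Fin 2 → ℚ × ℚ) (r : Fin J → Fin 2 → ℚ) (R : Fin J → ℚ)
      (k : Fin J → Fin 2 → Finset (Fin 2) → ℕ), (∀ j i, 0 < r j i) → (∀ j, 0 < R j) →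
      volume {s : unitInterval | ∀ j t, ∀ S : Finset (Fin 2), S.Nonempty →
        typedPatternCount (X s) t (fun i ↦ (⟨(x j i).1, (x j i).2⟩ : ℂ)) (fun i ↦ (r j i : ℝ)) (R j) S =
          k j t S} =
      volume {s : unitInterval | ∀ j t, ∀ S : Finset (Fin 2), S.Nonempty →
        typedPatternCount (X' s) t (fun i ↦ (⟨(x j i).1, (x j i).2⟩ : ℂ)) (fun i ↦ (r j i : ℝ)) (R j) S =
          k j t S}) →
    ∃ P : Measure (unitInterval × unitInterval), P.map Prod.fst = volume ∧ P.map Prod.snd = volume ∧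
      ∀ᵐ q ∂P, ∀ (i : Fin 2) (x : Fin 2 → ℚ × ℚ) (r : Fin 2 → ℚ) (R : ℚ) (S : Finset (Fin 2)),
        (∀ j, 0 < r j) → S.Nonempty →
        typedPatternCount (X q.1) i (fun j ↦ (⟨(x j).1, (x j).2⟩ : ℂ)) (fun j ↦ (r j : ℝ)) R S =
          typedPatternCount (X' q.2) i (fun j ↦ (⟨(x j).1, (x j).2⟩ : ℂ)) (fun j ↦ (r j : ℝ)) R S := by
  intro X X' hmeas hcyl
  classical
  -- the countable typed count statistic at positive rational data (`0` at the empty pattern)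
  set Φ : LoopConfig ℂ → ((Fin 2 → ℚ × ℚ) × (Fin 2 → {s : ℚ // 0 < s}) × {R : ℚ // 0 < R}) →
      Fin 2 → Finset (Fin 2) → ℕ := fun c f t S ↦ if S.Nonempty then
        typedPatternCount c t (fun j ↦ (⟨(f.1 j).1, (f.1 j).2⟩ : ℂ)) (fun j ↦ ((f.2.1 j : ℚ) : ℝ))
          ((f.2.2 : ℚ) : ℝ) S else 0 with hΦ
  have hΦS : ∀ c f t S, S.Nonempty → Φ c f t S =
      typedPatternCount c t (fun j ↦ (⟨(f.1 j).1, (f.1 j).2⟩ : ℂ)) (fun j ↦ ((f.2.1 j : ℚ) : ℝ))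
        ((f.2.2 : ℚ) : ℝ) S := fun c f t S hS ↦ by simp only [hΦ, hS, if_true]
  have hΦ0 : ∀ c f t S, ¬ S.Nonempty → Φ c f t S = 0 := fun c f t S hS ↦ by simp only [hΦ, hS, if_false]
  clear_value Φ
  have hmΦ : ∀ Y : unitInterval → LoopConfig ℂ,
      (∀ (i : Fin 2) (n : ℕ) (x : Fin n → ℂ) (r : Fin n → ℝ) (R : ℝ) (S : Finset (Fin n)),
        Measurable fun s ↦ typedPatternCount (Y s) i x r R S) → Measurable fun s ↦ Φ (Y s) := by
    intro Y hY
    refine measurable_pi_iff.2 fun f ↦ measurable_pi_iff.2 fun t ↦ measurable_pi_iff.2 fun S ↦ ?_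
    by_cases hS : S.Nonempty
    · simp only [hΦS _ _ _ _ hS]
      exact hY t 2 _ _ _ S
    · simp only [hΦ0 _ _ _ _ hS]
      exact measurable_const
  have hm : Measurable fun s ↦ Φ (X s) := hmΦ X fun i n x r R S ↦ (hmeas i n x r R S).1
  have hm' : Measurable fun s ↦ Φ (X' s) := hmΦ X' fun i n x r R S ↦ (hmeas i n x r R S).2
  -- tuple point cylinders of the statistic are joint cylinder events (or empty)
  have hcylΦ : ∀ (Y : unitInterval → LoopConfig ℂ) {J : ℕ}
      (g : Fin J → (Fin 2 → ℚ × ℚ) × (Fin 2 → {s : ℚ // 0 < s}) × {R : ℚ // 0 < R})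
      (v : Fin J → Fin 2 → Finset (Fin 2) → ℕ), (∀ j t S, ¬ S.Nonempty → v j t S = 0) →
      {s | ∀ j, Φ (Y s) (g j) = v j} = {s | ∀ j t, ∀ S : Finset (Fin 2), S.Nonempty →
        typedPatternCount (Y s) t (fun i ↦ (⟨((g j).1 i).1, ((g j).1 i).2⟩ : ℂ))
          (fun i ↦ (((g j).2.1 i : ℚ) : ℝ)) (((g j).2.2 : ℚ) : ℝ) S = v j t S} := by
    intro Y J g v hv
    ext s
    simp only [mem_setOf_eq, funext_iff]
    refine forall_congr' fun j ↦ forall_congr' fun t ↦ forall_congr' fun S ↦ ?_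
    by_cases hS : S.Nonempty
    · simp only [hΦS _ _ _ _ hS, hS, forall_const]
    · simp only [hΦ0 _ _ _ _ hS, hS, IsEmpty.forall_iff, iff_true]
      exact (hv j t S hS).symm
  have hcylΦ' : ∀ (Y : unitInterval → LoopConfig ℂ) {J : ℕ}
      (g : Fin J → (Fin 2 → ℚ × ℚ) × (Fin 2 → {s : ℚ // 0 < s}) × {R : ℚ // 0 < R})
      (v : Fin J → Fin 2 → Finset (Fin 2) → ℕ), (¬ ∀ j t S, ¬ S.Nonempty → v j t S = 0) →
      {s | ∀ j, Φ (Y s) (g j) = v j} = ∅ := by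
    intro Y J g v hv
    refine Set.eq_empty_of_forall_notMem fun s hs ↦ hv fun j t S hS ↦ ?_
    exact (congrFun (congrFun (hs j) t) S).symm.trans (hΦ0 _ _ _ _ hS)
  -- equal laws of the statistic
  have hlaw : (volume : Measure unitInterval).map (fun s ↦ Φ (X s)) =
      (volume : Measure unitInterval).map (fun s ↦ Φ (X' s)) := by
    haveI : IsProbabilityMeasure ((volume : Measure unitInterval).map fun s ↦ Φ (X s)) :=
      Measure.isProbabilityMeasure_map hm.aemeasurable
    haveI : IsProbabilityMeasure ((volume : Measure unitInterval).map fun s ↦ Φ (X' s)) :=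
      Measure.isProbabilityMeasure_map hm'.aemeasurable
    refine measure_pi_ext_of_cylinders _ _ fun J g v ↦ ?_
    have hA : MeasurableSet {y : ((Fin 2 → ℚ × ℚ) × (Fin 2 → {s : ℚ // 0 < s}) × {R : ℚ // 0 < R}) →
        Fin 2 → Finset (Fin 2) → ℕ | ∀ j, y (g j) = v j} := by
      have : {y : ((Fin 2 → ℚ × ℚ) × (Fin 2 → {s : ℚ // 0 < s}) × {R : ℚ // 0 < R}) →
          Fin 2 → Finset (Fin 2) → ℕ | ∀ j, y (g j) = v j} = ⋂ j, (fun y ↦ y (g j)) ⁻¹' {v j} := by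
        ext y
        simp
      rw [this]
      exact MeasurableSet.iInter fun j ↦ measurable_pi_apply (g j) (measurableSet_singleton (v j))
    rw [Measure.map_apply hm hA, Measure.map_apply hm' hA]
    change volume {s | ∀ j, Φ (X s) (g j) = v j} = volume {s | ∀ j, Φ (X' s) (g j) = v j}
    by_cases hv : ∀ j t S, ¬ S.Nonempty → v j t S = 0
    · rw [hcylΦ X g v hv, hcylΦ X' g v hv]
      exact hcyl J (fun j ↦ (g j).1) (fun j i ↦ ((g j).2.1 i : ℚ)) (fun j ↦ ((g j).2.2 : ℚ)) v
        (fun j i ↦ ((g j).2.1 i).2) (fun j ↦ (g j).2.2.2)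
    · rw [hcylΦ' X g v hv, hcylΦ' X' g v hv]
  -- couple along the statistic
  obtain ⟨P, h₁, h₂, hP⟩ := exists_coupling_volume_eq_of_map_eq _ _ hm hm' hlaw
  refine ⟨P, h₁, h₂, ?_⟩
  filter_upwards [hP] with q hq i x r R S hr hS
  by_cases hR : 0 < R
  · have key := congrFun (congrFun (congrFun hq (x, fun j ↦ ⟨r j, hr j⟩, ⟨R, hR⟩)) i) S
    rwa [hΦS _ _ _ _ hS, hΦS _ _ _ _ hS] at key
  · have hR' : (R : ℝ) ≤ 0 := by exact_mod_cast not_lt.1 hR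
    simp only [typedPatternCount, patternCount_eq_zero_of_nonpos _ _ _ hR']

/-! ## §3 Law level: a coupling carrying interior-and-type-preserving bijections -/

/-- **Equal joint typed cylinder probabilities of a.e. regular presentations give a coupling under which the
typed interior multisets agree almost surely (law level, routing-blind; registered anchor).**  Let `X, X'` be
presentations on `([0,1], Leb)` with a.e. `Regular` values and measurable typed pattern counts whose joint
typed cylinder probabilities at positive rational data agree.  Then there is a coupling `P` of `(Leb, Leb)`
such that for `P`-a.e. `(s, s')` and each type `i`, the type-`i` loops of `X s` and of `X' s'` are in a
bijection preserving the winding interiors (§2, then §1 pathwise).  This is the strongest conclusion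
available without a rigidity statement "equal interior and type ⇒ `udist = 0`" on the support. -/
theorem exists_coupling_typed_interiorEquiv_of_typedCylinders_eq :
    ∀ (X X' : unitInterval → LoopConfig ℂ),
    (∀ᵐ s : unitInterval, Regular (X s)) → (∀ᵐ s : unitInterval, Regular (X' s)) →
    (∀ (i : Fin 2) (n : ℕ) (x : Fin n → ℂ) (r : Fin n → ℝ) (R : ℝ) (S : Finset (Fin n)),
      Measurable (fun s ↦ typedPatternCount (X s) i x r R S) ∧
      Measurable (fun s ↦ typedPatternCount (X' s) i x r R S)) →
    (∀ (J : ℕ) (x : Fin J → Fin 2 → ℚ × ℚ) (r : Fin J → Fin 2 → ℚ) (R : Fin J → ℚ)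
      (k : Fin J → Fin 2 → Finset (Fin 2) → ℕ), (∀ j i, 0 < r j i) → (∀ j, 0 < R j) →
      volume {s : unitInterval | ∀ j t, ∀ S : Finset (Fin 2), S.Nonempty →
        typedPatternCount (X s) t (fun i ↦ (⟨(x j i).1, (x j i).2⟩ : ℂ)) (fun i ↦ (r j i : ℝ)) (R j) S =
          k j t S} =
      volume {s : unitInterval | ∀ j t, ∀ S : Finset (Fin 2), S.Nonempty →
        typedPatternCount (X' s) t (fun i ↦ (⟨(x j i).1, (x j i).2⟩ : ℂ)) (fun i ↦ (r j i : ℝ)) (R j) S =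
          k j t S}) →
    ∃ P : Measure (unitInterval × unitInterval), P.map Prod.fst = volume ∧ P.map Prod.snd = volume ∧
      ∀ᵐ q ∂P, ∀ i : Fin 2, ∃ e : (X q.1).F i ≃ (X' q.2).F i, ∀ u : (X q.1).F i,
        {w | (e u : UnbasedLoop ℂ).wind w ≠ 0} = {w | (u : UnbasedLoop ℂ).wind w ≠ 0} := by
  intro X X' hX hX' hmeas hcyl
  obtain ⟨P, h₁, h₂, hP⟩ := exists_coupling_typedCounts_eq_of_typedCylinders_eq X X' hmeas hcyl
  refine ⟨P, h₁, h₂, ?_⟩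
  filter_upwards [hP, ae_fst_of_map_fst_eq h₁ hX, ae_snd_of_map_snd_eq h₂ hX'] with q hq h1 h2
  exact exists_typed_interiorEquiv_of_typedCounts_eq h1 h2 hq

end Summit.CriticalPhenomena.CardyFormulaZ2.Cruxes.NestingRigidity.PositiveConeWeightDoubling

end
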